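import Literature.AlgebraicGeometry.ShimuraVarieties.UnitaryBallRealPoints
import Literature.AlgebraicGeometry.ShimuraVarieties.UnitaryBallUniformisationLocalSection
import Literature.AlgebraicGeometry.HodgeTheory.RationalHodgeClasses
import Literature.Analysis.Complex.HolomorphyDescentAlongOpenMaps
import Literature.NumberTheory.Transcendental.AnalytificationLocalBiholomorphism
import Literature.NumberTheory.Transcendental.AnalytificationMorphisms
import HarnessLib

/-!
# Hecke translations between compact quotients of the negative cone: the point map, continuity, the
# holomorphic lift, and — for CURVES (`p = 1`, disc quotients) — holomorphy and algebraicity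

Topic `AlgebraicGeometry/ShimuraVarieties`, namespace `Literature.AlgebraicGeometry.ShimuraVarieties`
(grouping sub-namespace `UnitaryConeHeckeTranslation`; datum API dotted on `UnitaryBallUniformisationDatum`).
THEOREMS ONLY (no definition, no named fact, no `sorry`).

For two ball-quotient data `D₁ : UnitaryBallUniformisationDatum p X₁`, `D₂ : UnitaryBallUniformisationDatum p X₂`
(★ `UnitaryBallQuotientDatum.lean`: `Xᵢ(ℂ) = Γᵢ \ 𝔹ᵖ` as a set through `unifᵢ` on the negative cone, continuous,
open, onto, holomorphic in algebraic coordinates) and an ISOMETRY `g ∈ GL_{p+1}(ℂ)`, `gᴴ H₂^{τ₁} g = H₁^{τ₁}`,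
conjugating `Γ₁^{τ₁}` into `Γ₂^{τ₁}`, this file is the RANK-GENERIC, CONE-COORDINATE form of §§1–2 of ★
`UnitaryBallHeckeTranslation` (which is hard-wired to `p = 2`, `Fin 3`, the ball model `𝔹² ⊂ ℂ²`):

* §1 (any `p`) `mulVec_mem_cone`, `unif_mulVec_eq_of_unif_eq`, `exists_map_unif_mulVec_eq` — the Hecke
  translation `f : X₁(ℂ) → X₂(ℂ)`, `f (unif₁ v) = unif₂ (g v)` on the cone, exists ([Shimura1973] §7.2–7.3;
  [BergeronMillsonMoeglin2016Balls] Introduction §1.1); `continuous_of_map_unif_mulVec_eq` — ANY such `f` is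
  continuous (`unif₁` is a quotient map onto `X₁(ℂ)`);
* §2 (any `p`) `nhds_le_map_unif`, `nhds_le_map_symm_comp_unif` — the uniformisation and its lift
  `(X^an ≃ₜ X(ℂ))⁻¹ ∘ unif` to a Hodge model are open at every cone vector; the lift is holomorphic on the cone by ★
  `UnitaryBallUniformisationDatum.mdifferentiableAt_symm_comp_unif` (`UnitaryBallUniformisationLocalSection`, generic engine ★
  `IsAnalytification.mdifferentiableAt_symm_comp`, Serre GAGA §2);
* §3 (`p = 1`: Shimura CURVES, quotients of the disc of negative lines of a signature-`(1,1)` form)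
  `mdifferentiable_of_map_unif_mulVec_eq` — ANY `f` with `f (unif₁ v) = unif₂ (g v)`, read in Hodge models, is
  HOLOMORPHIC: `Φ ∘ ũ₁ = ũ₂ ∘ g` with `ũ₁` holomorphic and open onto the ONE-dimensional `X₁^an`, so holomorphy
  descends (★ `HolomorphyDescent.mdifferentiableAt_of_comp_of_nhds_le_map`: open mapping + Riemann's removable
  singularities theorem, [Forster1981] §1 Thm. 1.8) — NO proper-discontinuity / local-injectivity statement for
  the uniformisation of the curve is needed (contrast ★ `UnitaryBallHeckeTranslation.mdifferentiable_of_map_unif_mulVec_eq`,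
  which goes through the local biholomorphy of the ball uniformisation, [Borel1969] 7.13);
  `exists_hom_map_unif_mulVec_eq` — under the record ★ `Arapura2012_Cor_15_4_6` (discharged in the tree:
  `arapura2012_cor_15_4_6_holds`, kept a hypothesis to stay on a light import cone) `f` is a MORPHISM
  `X₁ ⟶ X₂` of the algebraic models: **the Hecke translation between compact Shimura curves is algebraic**
  ([Milne2005ShimuraVarieties] §13 p. 118 L25–26 «because of Theorem 3.14»).

Consumer: the complex half of [Milne2005ShimuraVarieties] Thm. 13.6 for the canonical model of the unitary
Shimura CURVE (`RecordSystemGS.exists_heckeComplex`, cell `hodgecm-mathlib`, GS programme u1).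

## References
* [Shimura1973] G. Shimura, *Introduction to the arithmetic theory of automorphic functions* (Publ. Math. Soc. Japan 11, 1971), §7.2–7.3.
* [BergeronMillsonMoeglin2016Balls] N. Bergeron, J. Millson, C. Moeglin, Acta Math. 216 (2016), Introduction §1.1,
  Part 2 §§1.1–1.3, §1.8.
* [Milne2005ShimuraVarieties] J. S. Milne, *Introduction to Shimura varieties* (2005/2017), §13 p. 118, Thm. 3.14.
* [Forster1981] O. Forster, *Lectures on Riemann Surfaces* (1981), §1 Thm. 1.8, Def. 1.9.
* [Arapura2012] D. Arapura, *Algebraic Geometry over the Complex Numbers* (2012), §15.4 Cor. 15.4.6.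
* [SerreGAGA1956] J.-P. Serre, GAGA, §2.
-/

noncomputable section

open Matrix Function Set Filter Topology
open scoped Manifold ContDiff
open Literature.NumberTheory.Transcendental
open Literature.AlgebraicGeometry.HodgeTheory (HodgeModel)
open Literature.AlgebraicGeometry.Motives (SchemeOver ComplexPoints AlgPoints)
open Literature.Analysis.Complex
open CategoryTheory

namespace Literature.AlgebraicGeometry.ShimuraVarieties

/-! ### §2 (datum API, any `p`): openness of `unif` at a point and the holomorphic lift -/

namespace UnitaryBallUniformisationDatum

variable {p : ℕ} {X : SchemeOver ℂ} (D : UnitaryBallUniformisationDatum p X)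

/-- **The uniformisation is open at every cone vector**: `𝓝 (unif v) ≤ map unif (𝓝 v)` for `v` in the
negative cone (field `isOpenMap_unif`, the cone being open). [cite: BergeronMillsonMoeglin2016Balls, Introduction §1.1] -/
theorem nhds_le_map_unif {v : Fin (p + 1) → ℂ} (hv : v ∈ D.cone) : 𝓝 (D.unif v) ≤ map D.unif (𝓝 v) := by
  intro t ht
  rw [Filter.mem_map] at ht
  obtain ⟨O, hOt, hOo, hvO⟩ := mem_nhds_iff.mp ht
  -- the open subset `O ∩ cone` of the cone, read in the subtype
  have hopen : IsOpen (D.cone.restrict D.unif '' (Subtype.val ⁻¹' O)) :=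
    D.isOpenMap_unif _ (hOo.preimage continuous_subtype_val)
  refine mem_of_superset (hopen.mem_nhds ⟨⟨v, hv⟩, hvO, rfl⟩) ?_
  rintro _ ⟨⟨w, hw⟩, hwO, rfl⟩
  exact hOt hwO

/-- The uniformisation restricted to the cone is a quotient map onto `X(ℂ)` (continuous, open, onto).
[cite: BergeronMillsonMoeglin2016Balls, Introduction §1.1] -/
theorem isQuotientMap_restrict_unif : IsQuotientMap (D.cone.restrict D.unif) :=
  D.isOpenMap_unif.isQuotientMap D.continuousOn_unif.restrict
    (fun P => let ⟨v, hv, hP⟩ := D.surjOn_unif (mem_univ P); ⟨⟨v, hv⟩, hP⟩)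

/-- The lift `(X^an ≃ₜ X(ℂ))⁻¹ ∘ unif` is open at every cone vector. [cite: BergeronMillsonMoeglin2016Balls, Introduction §1.1] -/
theorem nhds_le_map_symm_comp_unif (A : HodgeModel p X) {v : Fin (p + 1) → ℂ} (hv : v ∈ D.cone) :
    𝓝 ((A.isAnalytification.homeomorph.symm ∘ D.unif) v) ≤
      map (A.isAnalytification.homeomorph.symm ∘ D.unif) (𝓝 v) := by
  rw [← Filter.map_map, Function.comp_apply, ← A.isAnalytification.homeomorph.symm.map_nhds_eq]
  exact map_mono (D.nhds_le_map_unif hv)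

end UnitaryBallUniformisationDatum

/-! ### §1 (any `p`): the point-level translation `unif₁ v ↦ unif₂ (g v)` -/

namespace UnitaryConeHeckeTranslation

open UnitaryBallUniformisationDatum

variable {p : ℕ} {X₁ X₂ : SchemeOver ℂ} {D₁ : UnitaryBallUniformisationDatum p X₁}
  {D₂ : UnitaryBallUniformisationDatum p X₂} {g : GL (Fin (p + 1)) ℂ}

/-- An isometry `g : (ℂ^{p+1}, H₁^{τ₁}) → (ℂ^{p+1}, H₂^{τ₁})`, `gᴴ H₂ g = H₁`, maps the negative cone of `V₁` into
that of `V₂` (`⟪g v, g v⟫₂ = ⟪v, v⟫₁`). [cite: BergeronMillsonMoeglin2016Balls, Part 2 §1.3] -/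
theorem mulVec_mem_cone
    (hg : (g : Matrix (Fin (p + 1)) (Fin (p + 1)) ℂ)ᴴ * D₂.Hℂ * (g : Matrix (Fin (p + 1)) (Fin (p + 1)) ℂ) = D₁.Hℂ)
    {v : Fin (p + 1) → ℂ} (hv : v ∈ D₁.cone) : (g : Matrix (Fin (p + 1)) (Fin (p + 1)) ℂ) *ᵥ v ∈ D₂.cone := by
  rw [mem_negCone_iff, star_mulVec, mulVec_mulVec, dotProduct_mulVec, vecMul_vecMul, ← Matrix.mul_assoc, hg,
    ← dotProduct_mulVec]
  exact hv

/-- **`unif₂ (g v)` is constant on the fibres of `unif₁`** when `g` is an isometry conjugating `Γ₁^{τ₁}` into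
`Γ₂^{τ₁}`: the fibres of `unif₁` on the cone are the `Γ₁·ℂˣ`-orbits, and `γ v = c w` gives
`(g γ g⁻¹)(g v) = c (g w)` with `g γ g⁻¹ ∈ Γ₂^{τ₁}`.
[cite: Shimura1973, §7.2–7.3] [cite: BergeronMillsonMoeglin2016Balls, Introduction §1.1] -/
theorem unif_mulVec_eq_of_unif_eq
    (hg : (g : Matrix (Fin (p + 1)) (Fin (p + 1)) ℂ)ᴴ * D₂.Hℂ * (g : Matrix (Fin (p + 1)) (Fin (p + 1)) ℂ) = D₁.Hℂ)
    (hΓ : (D₁.Γ.map (Matrix.GeneralLinearGroup.map D₁.τ₁)).map (MulAut.conj g).toMonoidHom ≤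
      D₂.Γ.map (Matrix.GeneralLinearGroup.map D₂.τ₁))
    {v w : Fin (p + 1) → ℂ} (hv : v ∈ D₁.cone) (hw : w ∈ D₁.cone) (h : D₁.unif v = D₁.unif w) :
    D₂.unif ((g : Matrix (Fin (p + 1)) (Fin (p + 1)) ℂ) *ᵥ v) =
      D₂.unif ((g : Matrix (Fin (p + 1)) (Fin (p + 1)) ℂ) *ᵥ w) := by
  obtain ⟨γ, hγ, c, hc, hγv⟩ := (D₁.unif_eq_unif_iff v hv w hw).1 h
  have hmem : (MulAut.conj g).toMonoidHom (Matrix.GeneralLinearGroup.map D₁.τ₁ γ) ∈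
      D₂.Γ.map (Matrix.GeneralLinearGroup.map D₂.τ₁) :=
    hΓ (Subgroup.mem_map_of_mem _ (Subgroup.mem_map_of_mem _ hγ))
  obtain ⟨γ₂, hγ₂, hγeq⟩ := Subgroup.mem_map.1 hmem
  refine (D₂.unif_eq_unif_iff _ (mulVec_mem_cone hg hv) _ (mulVec_mem_cone hg hw)).2 ⟨γ₂, hγ₂, c, hc, ?_⟩
  have hmat : ((γ₂ : GL (Fin (p + 1)) D₂.E) : Matrix (Fin (p + 1)) (Fin (p + 1)) D₂.E).map D₂.τ₁ =
      (g : Matrix (Fin (p + 1)) (Fin (p + 1)) ℂ) *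
        ((γ : GL (Fin (p + 1)) D₁.E) : Matrix (Fin (p + 1)) (Fin (p + 1)) D₁.E).map D₁.τ₁ *
        ((g⁻¹ : GL (Fin (p + 1)) ℂ) : Matrix (Fin (p + 1)) (Fin (p + 1)) ℂ) := by
    have hm := congrArg (fun x : GL (Fin (p + 1)) ℂ ↦ (x : Matrix (Fin (p + 1)) (Fin (p + 1)) ℂ)) hγeq
    simpa only [coe_generalLinearGroup_map, MulEquiv.coe_toMonoidHom, MulAut.conj_apply, Units.val_mul]
      using hm
  rw [hmat, mulVec_mulVec, Matrix.mul_assoc _ ((g⁻¹ : GL (Fin (p + 1)) ℂ) : Matrix (Fin (p + 1)) (Fin (p + 1)) ℂ)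
      (g : Matrix (Fin (p + 1)) (Fin (p + 1)) ℂ), Units.inv_mul, Matrix.mul_one, ← mulVec_mulVec, hγv, mulVec_smul]

/-- **The Hecke translation on complex points** exists: a map `f : X₁(ℂ) → X₂(ℂ)` with `f (unif₁ v) = unif₂ (g v)`
on the cone (`unif₁` is onto and `unif₂ ∘ g` is constant on its fibres).
[cite: Shimura1973, §7.2–7.3] [cite: BergeronMillsonMoeglin2016Balls, Introduction §1.1] -/
theorem exists_map_unif_mulVec_eq
    (hg : (g : Matrix (Fin (p + 1)) (Fin (p + 1)) ℂ)ᴴ * D₂.Hℂ * (g : Matrix (Fin (p + 1)) (Fin (p + 1)) ℂ) = D₁.Hℂ)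
    (hΓ : (D₁.Γ.map (Matrix.GeneralLinearGroup.map D₁.τ₁)).map (MulAut.conj g).toMonoidHom ≤
      D₂.Γ.map (Matrix.GeneralLinearGroup.map D₂.τ₁)) :
    ∃ f : ComplexPoints X₁ → ComplexPoints X₂,
      ∀ v ∈ D₁.cone, f (D₁.unif v) = D₂.unif ((g : Matrix (Fin (p + 1)) (Fin (p + 1)) ℂ) *ᵥ v) := by
  have hsec : ∀ P : ComplexPoints X₁, ∃ v ∈ D₁.cone, D₁.unif v = P := fun P ↦ D₁.surjOn_unif (mem_univ P)
  choose s hs hsP using hsec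
  exact ⟨fun P ↦ D₂.unif ((g : Matrix (Fin (p + 1)) (Fin (p + 1)) ℂ) *ᵥ s P),
    fun v hv ↦ unif_mulVec_eq_of_unif_eq hg hΓ (hs _) hv (hsP _)⟩

/-- **Any map intertwining `unif₁` with `unif₂ ∘ g` is continuous**, for a matrix `g` (possibly rectangular, into a
ball-quotient datum of another dimension) mapping the cone of `D₁` into the cone of `D₂`: `unif₁` on the cone is a quotient
map onto `X₁(ℂ)` and `f ∘ unif₁ = unif₂ ∘ g` is continuous on the cone. [cite: BergeronMillsonMoeglin2016Balls, Introduction §1.1] -/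
theorem continuous_of_map_unif_mulVec_eq {p₂ : ℕ} {X₃ : SchemeOver ℂ} {D₃ : UnitaryBallUniformisationDatum p₂ X₃}
    {m : Matrix (Fin (p₂ + 1)) (Fin (p + 1)) ℂ} (hm : ∀ v ∈ D₁.cone, m *ᵥ v ∈ D₃.cone)
    {f : ComplexPoints X₁ → ComplexPoints X₃} (hf : ∀ v ∈ D₁.cone, f (D₁.unif v) = D₃.unif (m *ᵥ v)) :
    Continuous f := by
  rw [D₁.isQuotientMap_restrict_unif.continuous_iff]
  have heq : f ∘ D₁.cone.restrict D₁.unif =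
      D₃.cone.restrict D₃.unif ∘ fun v : D₁.cone => (⟨m *ᵥ (v : Fin (p + 1) → ℂ), hm v v.2⟩ : D₃.cone) := by
    funext v
    exact hf v v.2
  rw [heq]
  refine D₃.continuousOn_unif.restrict.comp (Continuous.subtype_mk ?_ _)
  exact ((Matrix.mulVecLin m).continuous_of_finiteDimensional).comp continuous_subtype_val

/-! ### §3 (`p = 1`): maps out of compact Shimura CURVES lifting to linear maps of the cones are holomorphic -/

variable {Y₁ Y₂ : SchemeOver ℂ} {C₁ : UnitaryBallUniformisationDatum 1 Y₁} {C₂ : UnitaryBallUniformisationDatum 1 Y₂}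
  {g₁ : GL (Fin 2) ℂ}

/-- **Maps out of a compact Shimura curve that lift to a linear map of the cones are holomorphic.**  For a disc-quotient
datum `C₁` (`p = 1`), a ball-quotient datum `D₃` of ANY dimension `p₂`, a matrix `m : ℂ² → ℂ^{p₂+1}` mapping the negative
cone of `C₁` into that of `D₃` (e.g. an isometry `γ^τ` of `J⋆^τ`, or an isometric embedding `v ↦ B^τ(v ⊕ 0)` of `J⋆^τ` into a
rank-3 form), and ANY map `f : Y₁(ℂ) → X₃(ℂ)` with `f (unif₁ v) = unif₃ (m v)` on the cone, `f` read in Hodge models `A₁`,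
`A₃` is holomorphic: with `ũ = (X^an ≃ₜ X(ℂ))⁻¹ ∘ unif` (holomorphic on the cone, `mdifferentiableAt_symm_comp_unif`; open at
every cone vector, `nhds_le_map_symm_comp_unif`) one has `Φ ∘ ũ₁ = ũ₃ ∘ m` near every cone vector, `Φ` is continuous
(`continuous_of_map_unif_mulVec_eq`), and `Y₁^an` has dimension ONE, so holomorphy descends to `Φ`
(★ `HolomorphyDescent.mdifferentiableAt_of_comp_of_nhds_le_map`: open mapping theorem + Riemann's removable singularities).
No local-biholomorphy / proper-discontinuity statement for `unif₁` is used.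
[cite: Forster1981, §1 Thm. 1.8 and Def. 1.9] [cite: Shimura1973, §7.2–7.3] [cite: SerreGAGA1956, §2] -/
theorem mdifferentiable_of_map_unif_mulVec_eq {p₂ : ℕ} {X₃ : SchemeOver ℂ} {D₃ : UnitaryBallUniformisationDatum p₂ X₃}
    {m : Matrix (Fin (p₂ + 1)) (Fin 2) ℂ} (hm : ∀ v ∈ C₁.cone, m *ᵥ v ∈ D₃.cone)
    {f : ComplexPoints Y₁ → ComplexPoints X₃} (hf : ∀ v ∈ C₁.cone, f (C₁.unif v) = D₃.unif (m *ᵥ v))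
    (A₁ : HodgeModel 1 Y₁) (A₃ : HodgeModel p₂ X₃) :
    MDifferentiable 𝓘(ℂ, A₁.model) 𝓘(ℂ, A₃.model)
      (fun x ↦ A₃.isAnalytification.homeomorph.symm (f (A₁.toComplexPoints x))) := by
  set Φ : A₁.carrier → A₃.carrier := fun x ↦ A₃.isAnalytification.homeomorph.symm (f (A₁.toComplexPoints x))
    with hΦ
  have hfc : Continuous f := continuous_of_map_unif_mulVec_eq hm hf
  have hΦc : Continuous Φ :=
    A₃.isAnalytification.homeomorph.symm.continuous.comp (hfc.comp A₁.isAnalytification.isHomeomorph.continuous)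
  intro x
  -- a cone vector over `x`
  obtain ⟨v, hv, hvx⟩ := C₁.surjOn_unif (mem_univ (A₁.toComplexPoints x))
  set u₁ : (Fin 2 → ℂ) → A₁.carrier := A₁.isAnalytification.homeomorph.symm ∘ C₁.unif with hu₁
  set u₃ : (Fin (p₂ + 1) → ℂ) → A₃.carrier := A₃.isAnalytification.homeomorph.symm ∘ D₃.unif with hu₃
  have hux : u₁ v = x := by
    simp only [hu₁, Function.comp_apply, hvx]
    exact A₁.isAnalytification.homeomorph.symm_apply_apply x
  rw [← hux]
  refine HolomorphyDescent.mdifferentiableAt_of_comp_of_nhds_le_map A₁.isAnalytification.finrank_eq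
    (u := u₁) (Φ := Φ) (z := v) ?_ (C₁.nhds_le_map_symm_comp_unif A₁ hv) ?_ hΦc.continuousAt
  · -- `u₁` is holomorphic near `v`
    filter_upwards [(isOpen_negCone _).mem_nhds hv] with y hy
    exact C₁.mdifferentiableAt_symm_comp_unif A₁ hy
  · -- `Φ ∘ u₁ = u₃ ∘ m` near `v`, and the right-hand side is holomorphic
    filter_upwards [(isOpen_negCone _).mem_nhds hv] with y hy
    have hlin : MDifferentiableAt 𝓘(ℂ, Fin 2 → ℂ) 𝓘(ℂ, Fin (p₂ + 1) → ℂ) (fun w : Fin 2 → ℂ ↦ m *ᵥ w) y :=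
      mdifferentiableAt_iff_differentiableAt.mpr ((Matrix.mulVecLin m).toContinuousLinearMap.differentiableAt)
    have hcomp : MDifferentiableAt 𝓘(ℂ, Fin 2 → ℂ) 𝓘(ℂ, A₃.model) (u₃ ∘ fun w : Fin 2 → ℂ ↦ m *ᵥ w) y :=
      (D₃.mdifferentiableAt_symm_comp_unif A₃ (hm y hy)).comp y hlin
    refine hcomp.congr_of_eventuallyEq ?_
    filter_upwards [(isOpen_negCone _).mem_nhds hy] with y' hy'
    simp only [hΦ, hu₁, hu₃, Function.comp_apply]
    have h₁ : A₁.toComplexPoints (A₁.isAnalytification.homeomorph.symm (C₁.unif y')) = C₁.unif y' :=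
      A₁.isAnalytification.homeomorph.apply_symm_apply _
    rw [h₁, hf y' hy']

/-- **A map out of a compact Shimura curve lifting to a linear map of the cones is a morphism of the algebraic models**
(under the record ★ `Arapura2012_Cor_15_4_6`, a tree theorem `arapura2012_cor_15_4_6_holds`): for `C₁` (`p = 1`), `D₃` of any
dimension, `m` mapping cone into cone and ANY `f : Y₁(ℂ) → X₃(ℂ)` with `f (unif₁ v) = unif₃ (m v)` on the cone, there is
`φ : Y₁ ⟶ X₃` over `ℂ` with `φ(ℂ) = f`.  Serves both the Hecke translations of the curve (square isometries `γ^τ`) and the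
embedding of the curve into the Shimura surface along `v ↦ B^τ(v ⊕ 0)` (rectangular `m`).
[cite: Arapura2012, §15.4 Cor. 15.4.6] [cite: Milne2005ShimuraVarieties, §13 p. 118 L25–26] -/
theorem exists_hom_map_eq_of_map_unif_mulVec_eq (hA : Arapura2012_Cor_15_4_6) {p₂ : ℕ} {X₃ : SchemeOver ℂ}
    {D₃ : UnitaryBallUniformisationDatum p₂ X₃} {m : Matrix (Fin (p₂ + 1)) (Fin 2) ℂ}
    (hm : ∀ v ∈ C₁.cone, m *ᵥ v ∈ D₃.cone) {f : ComplexPoints Y₁ → ComplexPoints X₃}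
    (hf : ∀ v ∈ C₁.cone, f (C₁.unif v) = D₃.unif (m *ᵥ v)) (A₁ : HodgeModel 1 Y₁) (A₃ : HodgeModel p₂ X₃) :
    ∃ φ : Y₁ ⟶ X₃, ∀ P : ComplexPoints Y₁, AlgPoints.map φ P = f P := by
  obtain ⟨φ, hφ⟩ := hA Y₁ X₃ C₁.isSmoothProjective D₃.isSmoothProjective A₁.model A₁.carrier
    A₁.toComplexPoints A₁.isAnalytification A₃.model A₃.carrier A₃.toComplexPoints
    A₃.isAnalytification _ (mdifferentiable_of_map_unif_mulVec_eq hm hf A₁ A₃)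
  refine ⟨φ, fun P ↦ ?_⟩
  have h := hφ (A₁.isAnalytification.homeomorph.symm P)
  have h₁ : A₁.toComplexPoints (A₁.isAnalytification.homeomorph.symm P) = P :=
    A₁.isAnalytification.homeomorph.apply_symm_apply _
  have h₂ : A₃.toComplexPoints (A₃.isAnalytification.homeomorph.symm (f P)) = f P :=
    A₃.isAnalytification.homeomorph.apply_symm_apply _
  rw [h₁, h₂] at h
  exact h.symm

/-- **The Hecke translation between compact Shimura curves is a morphism of the algebraic models** (under the
record ★ `Arapura2012_Cor_15_4_6`: a holomorphic map between nonsingular projective varieties is a morphism; a tree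
theorem, `arapura2012_cor_15_4_6_holds`): for disc-quotient data `C₁`, `C₂`, an isometry `g₁` with
`g₁ Γ₁^{τ₁} g₁⁻¹ ≤ Γ₂^{τ₁}`, there is `f : Y₁ ⟶ Y₂` over `ℂ` with `f(ℂ) (unif₁ v) = unif₂ (g₁ v)` on the cone.  The Hodge
models `A₁`, `A₂` are inputs; the conclusion does not mention them.  («The map `T(g)` is a morphism of algebraic
varieties over `ℂ`», [Milne2005ShimuraVarieties] p. 118 L25–26, for compact Shimura curves.)
[cite: Arapura2012, §15.4 Cor. 15.4.6] [cite: Milne2005ShimuraVarieties, §13 p. 118 L25–26] [cite: Shimura1973, §7.2–7.3] -/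
theorem exists_hom_map_unif_mulVec_eq (hA : Arapura2012_Cor_15_4_6)
    (hg : (g₁ : Matrix (Fin 2) (Fin 2) ℂ)ᴴ * C₂.Hℂ * (g₁ : Matrix (Fin 2) (Fin 2) ℂ) = C₁.Hℂ)
    (hΓ : (C₁.Γ.map (Matrix.GeneralLinearGroup.map C₁.τ₁)).map (MulAut.conj g₁).toMonoidHom ≤
      C₂.Γ.map (Matrix.GeneralLinearGroup.map C₂.τ₁))
    (A₁ : HodgeModel 1 Y₁) (A₂ : HodgeModel 1 Y₂) :
    ∃ f : Y₁ ⟶ Y₂, ∀ v ∈ C₁.cone,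
      AlgPoints.map f (C₁.unif v) = C₂.unif ((g₁ : Matrix (Fin 2) (Fin 2) ℂ) *ᵥ v) := by
  obtain ⟨f, hf⟩ := exists_map_unif_mulVec_eq hg hΓ
  obtain ⟨φ, hφ⟩ := exists_hom_map_eq_of_map_unif_mulVec_eq hA (fun v hv => mulVec_mem_cone hg hv) hf A₁ A₂
  exact ⟨φ, fun v hv ↦ by rw [hφ, hf v hv]⟩

/-- The same with the analytifications supplied by any existence statement for Hodge models (e.g. the tree's
`HodgeTheory.exists_isReal_hodgeModel_holds 1`). [cite: Arapura2012, §15.4 Cor. 15.4.6] [cite: Shimura1973, §7.2–7.3] -/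
theorem exists_hom_map_unif_mulVec_eq_of_nonempty (hA : Arapura2012_Cor_15_4_6)
    (hA₁ : Nonempty (HodgeModel 1 Y₁)) (hA₂ : Nonempty (HodgeModel 1 Y₂))
    (hg : (g₁ : Matrix (Fin 2) (Fin 2) ℂ)ᴴ * C₂.Hℂ * (g₁ : Matrix (Fin 2) (Fin 2) ℂ) = C₁.Hℂ)
    (hΓ : (C₁.Γ.map (Matrix.GeneralLinearGroup.map C₁.τ₁)).map (MulAut.conj g₁).toMonoidHom ≤
      C₂.Γ.map (Matrix.GeneralLinearGroup.map C₂.τ₁)) :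
    ∃ f : Y₁ ⟶ Y₂, ∀ v ∈ C₁.cone,
      AlgPoints.map f (C₁.unif v) = C₂.unif ((g₁ : Matrix (Fin 2) (Fin 2) ℂ) *ᵥ v) :=
  let ⟨A₁⟩ := hA₁; let ⟨A₂⟩ := hA₂; exists_hom_map_unif_mulVec_eq hA hg hΓ A₁ A₂

/-- **One hermitian space, `g₁ ∈ U(H^{τ₁})`** (the case of record: `C₁.Hℂ = C₂.Hℂ` and `g₁ = γ^{τ₁}` for a rational
isometry `γ`, with `Γ₁ ≤ γ⁻¹Γ₂γ`): the Hecke translation `[v] ↦ [g₁ v]` is a morphism `f : Y₁ ⟶ Y₂` with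
`f(ℂ) (unif₁ v) = unif₂ (g₁ v)` on the cone. [cite: Arapura2012, §15.4 Cor. 15.4.6] [cite: Shimura1973, §7.2–7.3] -/
theorem exists_hom_map_unif_mulVec_eq_of_mem_realPoints (hA : Arapura2012_Cor_15_4_6)
    (hA₁ : Nonempty (HodgeModel 1 Y₁)) (hA₂ : Nonempty (HodgeModel 1 Y₂)) (hH : C₁.Hℂ = C₂.Hℂ)
    (hg : g₁ ∈ C₂.realPoints)
    (hΓ : (C₁.Γ.map (Matrix.GeneralLinearGroup.map C₁.τ₁)).map (MulAut.conj g₁).toMonoidHom ≤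
      C₂.Γ.map (Matrix.GeneralLinearGroup.map C₂.τ₁)) :
    ∃ f : Y₁ ⟶ Y₂, ∀ v ∈ C₁.cone,
      AlgPoints.map f (C₁.unif v) = C₂.unif ((g₁ : Matrix (Fin 2) (Fin 2) ℂ) *ᵥ v) :=
  exists_hom_map_unif_mulVec_eq_of_nonempty hA hA₁ hA₂
    ((ConeChart.mem_unitaryGroup_conj_iff.mp hg).trans hH.symm) hΓ

end UnitaryConeHeckeTranslation

end Literature.AlgebraicGeometry.ShimuraVarieties

end
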